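import Mathlib
import Summits.NavierStokesRegularity.NavierStokesRegularity.Theorems.SqueezeCycleRecurrentLiouvilleConstOfTendsto
import HarnessLib

/-!
# Semi-Lyapunov rigidity on recurrent orbits (tools of line `Ideator5Round2Sketch`, crux `RecurrentLiouville`)

Topological dynamics, no PDE; corollaries of
`Theorems/SqueezeCycleRecurrentLiouvilleConstOfTendsto.lean` (`const_of_tendsto_of_isUniformlyRecurrentPt`:
along a uniformly recurrent orbit of a jointly continuous `ℝ`-action, a continuous observable that
converges as `s → +∞` is constant on the orbit).  This file records the form in which the crux's own
docstring wants it ("Tools recurrence buys: (a) a functional continuous on the orbit closure and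
non-increasing along the flow is CONSTANT on a minimal set — semi-Lyapunov rigidity, no
coercivity"):

* `const_of_monotone_of_isUniformlyRecurrentPt` / `const_of_antitone_of_isUniformlyRecurrentPt` —
  a continuous observable that is monotone (resp. antitone) and bounded above (resp. below) along a
  uniformly recurrent orbit is constant on the orbit (monotone limits + the lemma above);
* `eq_of_antitone_of_isUniformlyRecurrentPt_of_compactSpace` — on a COMPACT phase space the bound is
  automatic: a continuous semi-Lyapunov functional (non-increasing along the orbit of a uniformly
  recurrent point `x`) is constant, equal to `φ x`, on the whole orbit closure of `x`;
  `eq_of_monotone_of_isUniformlyRecurrentPt_of_compactSpace` — the non-decreasing twin;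
* `stub_semiLyapunovRigidityTools` — registered tools stub (the two compact forms) of crux item
  stmt-NavierStokesRegularity-1589.

## References

* H. Furstenberg, *Recurrence in Ergodic Theory and Combinatorial Number Theory*, Princeton UP
  (1981), Ch. 1 §4 (Def. 1.7 syndetic, Def. 1.8 uniformly recurrent).
-/

-- the sub-problem namespace repeats the summit name (D-0017 layout `Summit.<S>.<P>.Theorems`)
set_option linter.dupNamespace false

namespace Summit.NavierStokesRegularity.NavierStokesRegularity.Theorems

open Set Function Filter Topology
open Literature.Dynamics.TopologicalDynamics

variable {X : Type*} [TopologicalSpace X]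

/-- **Monotone + bounded + recurrent ⇒ constant**: a continuous observable that is non-decreasing
and bounded above along the orbit of a uniformly recurrent point of a jointly continuous `ℝ`-action
is constant on the orbit (it converges to its supremum as `s → +∞`, and convergent + recurrent ⇒
constant). [folklore] -/
theorem const_of_monotone_of_isUniformlyRecurrentPt {ϕ : ℝ → X → X}
    (hcont : Continuous fun p : ℝ × X => ϕ p.1 p.2) (hadd : ∀ s t y, ϕ (s + t) y = ϕ s (ϕ t y))
    {φ : X → ℝ} (hφ : Continuous φ) {x : X} (hx : IsUniformlyRecurrentPt ϕ x)
    (hmono : Monotone fun s => φ (ϕ s x)) (hbdd : BddAbove (range fun s => φ (ϕ s x))) (s t : ℝ) :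
    φ (ϕ s x) = φ (ϕ t x) := by
  have hlim := tendsto_atTop_ciSup hmono hbdd
  rw [const_of_tendsto_of_isUniformlyRecurrentPt hcont hadd hφ hx hlim s,
    const_of_tendsto_of_isUniformlyRecurrentPt hcont hadd hφ hx hlim t]

/-- **Antitone + bounded + recurrent ⇒ constant**: a continuous observable that is non-increasing
and bounded below along the orbit of a uniformly recurrent point of a jointly continuous `ℝ`-action
is constant on the orbit. [folklore] -/
theorem const_of_antitone_of_isUniformlyRecurrentPt {ϕ : ℝ → X → X}
    (hcont : Continuous fun p : ℝ × X => ϕ p.1 p.2) (hadd : ∀ s t y, ϕ (s + t) y = ϕ s (ϕ t y))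
    {φ : X → ℝ} (hφ : Continuous φ) {x : X} (hx : IsUniformlyRecurrentPt ϕ x)
    (hanti : Antitone fun s => φ (ϕ s x)) (hbdd : BddBelow (range fun s => φ (ϕ s x))) (s t : ℝ) :
    φ (ϕ s x) = φ (ϕ t x) := by
  have hlim := tendsto_atTop_ciInf hanti hbdd
  rw [const_of_tendsto_of_isUniformlyRecurrentPt hcont hadd hφ hx hlim s,
    const_of_tendsto_of_isUniformlyRecurrentPt hcont hadd hφ hx hlim t]

/-- **Semi-Lyapunov rigidity on a compact phase space**: if a continuous observable `φ` is
non-increasing along the orbit of a uniformly recurrent point `x` of a jointly continuous `ℝ`-action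
with `ϕ 0 = id` on a compact space, then `φ` is constant, equal to `φ x`, on the orbit closure of `x`
(continuous functions on compact spaces are bounded; antitone + bounded + recurrent ⇒ constant on
the orbit; continuity extends the identity to the closure). [folklore] -/
theorem eq_of_antitone_of_isUniformlyRecurrentPt_of_compactSpace [CompactSpace X] {ϕ : ℝ → X → X}
    (hcont : Continuous fun p : ℝ × X => ϕ p.1 p.2) (hadd : ∀ s t y, ϕ (s + t) y = ϕ s (ϕ t y))
    (h0 : ∀ y, ϕ 0 y = y) {φ : X → ℝ} (hφ : Continuous φ) {x : X} (hx : IsUniformlyRecurrentPt ϕ x)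
    (hanti : Antitone fun s => φ (ϕ s x)) :
    ∀ y ∈ closure (range fun s : ℝ => ϕ s x), φ y = φ x := by
  have hbdd : BddBelow (range fun s => φ (ϕ s x)) :=
    (isCompact_range hφ).bddBelow.mono (by rintro _ ⟨s, rfl⟩; exact ⟨ϕ s x, rfl⟩)
  have hsub : range (fun s : ℝ => ϕ s x) ⊆ {y | φ y = φ x} := by
    rintro _ ⟨s, rfl⟩
    have h := const_of_antitone_of_isUniformlyRecurrentPt hcont hadd hφ hx hanti hbdd s 0
    rwa [h0] at h
  exact fun y hy => (isClosed_eq hφ continuous_const).closure_subset_iff.2 hsub hy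

/-- **Semi-Lyapunov rigidity, non-decreasing twin**: on a compact phase space a continuous
observable non-decreasing along the orbit of a uniformly recurrent point `x` is constant, equal to
`φ x`, on the orbit closure of `x`. [folklore] -/
theorem eq_of_monotone_of_isUniformlyRecurrentPt_of_compactSpace [CompactSpace X] {ϕ : ℝ → X → X}
    (hcont : Continuous fun p : ℝ × X => ϕ p.1 p.2) (hadd : ∀ s t y, ϕ (s + t) y = ϕ s (ϕ t y))
    (h0 : ∀ y, ϕ 0 y = y) {φ : X → ℝ} (hφ : Continuous φ) {x : X} (hx : IsUniformlyRecurrentPt ϕ x)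
    (hmono : Monotone fun s => φ (ϕ s x)) :
    ∀ y ∈ closure (range fun s : ℝ => ϕ s x), φ y = φ x := by
  have hbdd : BddAbove (range fun s => φ (ϕ s x)) :=
    (isCompact_range hφ).bddAbove.mono (by rintro _ ⟨s, rfl⟩; exact ⟨ϕ s x, rfl⟩)
  have hsub : range (fun s : ℝ => ϕ s x) ⊆ {y | φ y = φ x} := by
    rintro _ ⟨s, rfl⟩
    have h := const_of_monotone_of_isUniformlyRecurrentPt hcont hadd hφ hx hmono hbdd s 0
    rwa [h0] at h
  exact fun y hy => (isClosed_eq hφ continuous_const).closure_subset_iff.2 hsub hy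

/-- **Registered tools stub `stub_semiLyapunovRigidityTools`** of crux stmt-NavierStokesRegularity-1589
(line `Ideator5Round2Sketch`): semi-Lyapunov rigidity on compact phase spaces, non-increasing ∧
non-decreasing forms. [folklore] -/
theorem stub_semiLyapunovRigidityTools :
    (∀ {X : Type*} [TopologicalSpace X] [CompactSpace X] (ϕ : ℝ → X → X), Continuous (fun p : ℝ × X => ϕ p.1 p.2) → (∀ s t y, ϕ (s + t) y = ϕ s (ϕ t y)) → (∀ y, ϕ 0 y = y) → ∀ (φ : X → ℝ), Continuous φ → ∀ (x : X), Literature.Dynamics.TopologicalDynamics.IsUniformlyRecurrentPt ϕ x → Antitone (fun s => φ (ϕ s x)) → ∀ y ∈ closure (Set.range fun s : ℝ => ϕ s x), φ y = φ x) ∧ (∀ {X : Type*} [TopologicalSpace X] [CompactSpace X] (ϕ : ℝ → X → X), Continuous (fun p : ℝ × X => ϕ p.1 p.2) → (∀ s t y, ϕ (s + t) y = ϕ s (ϕ t y)) → (∀ y, ϕ 0 y = y) → ∀ (φ : X → ℝ), Continuous φ → ∀ (x : X), Literature.Dynamics.TopologicalDynamics.IsUniformlyRecurrentPt ϕ x →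 Monotone (fun s => φ (ϕ s x)) → ∀ y ∈ closure (Set.range fun s : ℝ => ϕ s x), φ y = φ x) :=
  ⟨fun _ hcont hadd h0 _ hφ _ hx hanti =>
      eq_of_antitone_of_isUniformlyRecurrentPt_of_compactSpace hcont hadd h0 hφ hx hanti,
    fun _ hcont hadd h0 _ hφ _ hx hmono =>
      eq_of_monotone_of_isUniformlyRecurrentPt_of_compactSpace hcont hadd h0 hφ hx hmono⟩

end Summit.NavierStokesRegularity.NavierStokesRegularity.Theorems
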